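import Mathlib
import HarnessLib
import Literature.Barriers.QuantumFields.CenterSymmetryBreakingByQuarks
import Summits.Ventures.LatticeQCDFlow.Exactness.KernelCouplingTranslation

/-!
# Plaquette-kernel coupling layers — `U(1)` spline / NCP, `SU(N)` spectral — commute with the global CENTRE transformation, for ANY group: the central twist factor slides past `h(P)P⁻¹`; exact Jacobians are centre blind

HONEST FRAMING: exact (Metropolis-corrected) sampling algorithms for lattice gauge theory;
figures of merit are autocorrelation/cost numbers at stated couplings and volumes; no
continuum-physics claim.

Venture `LatticeQCDFlow` (cell pub-lqcd), topic `Exactness`; FANOUT row 10 (`eng-equiv`, engine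
`latflow.equiv` / `latflow.flows_jax`: `u1.py` NCP / spline plaquette couplings, `spectral.py`
`SU(N)` spectral plaquette couplings — every one of them the KERNEL COUPLING LAYER
`V e ↦ h(V,e)(P_e) · P_e⁻¹ · V e` on active links of `KernelCouplingGaugeEquivariance` /
`KernelCouplingMask` / `KernelCouplingTranslation`).  NEW WORK of the cell; nothing is cited as a
fact; no number; no definition is introduced.  The Literature's centre transformation
(`Barriers/QuantumFields/CenterSymmetryBreakingByQuarks`: `centerTwist z t₀ U = twistConfig z t₀ · U`
multiplies the time-like links of one time slice by a central `z`; `plaquetteHolonomy_centerTwist`: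
plaquettes are centre blind; `centerTwistEquiv`, `map_centerTwist_pi_haar`) and GEN-12/13's
`HasJacobian.jac_comp_symm_ae_eq` / `jac_comp_symm_eq`.  Companion of `SUNStoutLayerCenterSymmetry`
(the stout layer); this file does the kernel coupling layers, for every group at once.

## What is typed (any group `G`, `d ≥ 1`, `L`, central `z`, slice `t₀`, any mask `p`)

* **`kernelLayer_centerTwist`** — loop field `P` and kernel data `h` centre blind on active links
  (`P(z·V, e) = P(V, e)`, `h(z·V, e) = h(V, e)`): `F(z·V) = z·F(V)` (the twist factor at `e` is
  central, so `h(P)P⁻¹ · (c_e V_e) = c_e · (h(P)P⁻¹ V_e)`);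
  **`plaquetteKernelLayer_centerTwist`** — for the plaquette loop field the first hypothesis IS
  `plaquetteHolonomy_centerTwist`; only the kernel data's centre blindness remains (a conditioner
  reading traces of plaquettes / contractible loops has it; one reading Polyakov lines does not);
* **`abelian_plaquetteKernelLayer_sliceTwist`** — for a COMMUTATIVE group (the engine's `U(1)`)
  every `z` is central: the `U(1)` NCP / spline plaquette coupling layers commute with EVERY slice
  twist `U(x⃗,t₀;0) ↦ z·U(x⃗,t₀;0)`, `z ∈ U(1)` — a continuous family of symmetries of the layer;
* `ae_centerInvariant_jacobian_of_comm` / **`centerInvariant_jacobian_of_comm`** — compact `G`,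
  product Haar: every exact Jacobian of a measurable automorphism `Ψ` of `G^E` commuting with the
  twist is centre blind a.e., and everywhere if continuous (so the booked `coupleJac` densities of
  `U1SplinePlaquetteCouplingLayer` / `SUNSpectralPlaquetteLayerShipped`, presented through their
  `exists_measurableEquiv_…` automorphisms, are centre blind a.e.);
  `centerInvariant_modelDensity_of_comm`.

NOT here: the sampler-level statement (sequel `FlowSamplerCenterSymmetry` covers any `Ψ` commuting
with the twist — these layers included); twists of links in a direction other than `0` (the
Literature's `twistConfig` fixes direction `0`; the lemma is direction-agnostic in content); numbers.
-/

noncomputable section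

namespace Summit.Ventures.LatticeQCDFlow.Exactness

open MeasureTheory
open Literature.MathematicalPhysics.QuantumFieldTheory
open Literature.Barriers.QuantumFields (twistConfig centerTwist centerTwist_apply twistConfig_mem_center
  plaquetteHolonomy_centerTwist centerTwistEquiv centerTwistEquiv_apply map_centerTwist_pi_haar)
open scoped ENNReal

variable {d L : ℕ} [NeZero d]

/-! ## Kernel coupling layers intertwine the centre transformation (any group) -/

section AnyGroup

variable {G : Type*} [Group G] {z : G} (hz : z ∈ Subgroup.center G) (t₀ : ZMod L)
include hz

/-- **Kernel coupling layers commute with the centre transformation** (any group; loop field and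
kernel data centre blind on the active links of the mask). -/
theorem kernelLayer_centerTwist (p : Edge d L → Prop) [DecidablePred p]
    (P : GaugeConfig d L G → Edge d L → G) (h : GaugeConfig d L G → Edge d L → G → G)
    (F : GaugeConfig d L G → GaugeConfig d L G)
    (hF : ∀ V e, F V e = if p e then h V e (P V e) * (P V e)⁻¹ * V e else V e)
    (hP : ∀ (V : GaugeConfig d L G) (e : Edge d L), p e → P (centerTwist z t₀ V) e = P V e)
    (hh : ∀ (V : GaugeConfig d L G) (e : Edge d L), p e → h (centerTwist z t₀ V) e = h V e)
    (V : GaugeConfig d L G) :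
    F (centerTwist z t₀ V) = centerTwist z t₀ (F V) := by
  funext e
  rw [hF, centerTwist_apply, centerTwist_apply, hF]
  by_cases he : p e
  · rw [if_pos he, if_pos he, hP V e he, hh V e he]
    have hc := Subgroup.mem_center_iff.1 (twistConfig_mem_center (d := d) (L := L) hz t₀ e)
    rw [show (if e.2 = 0 ∧ e.1 0 = t₀ then z else 1) = twistConfig z t₀ e from rfl, ← mul_assoc, hc, mul_assoc,
      mul_assoc]
  · rw [if_neg he, if_neg he]

/-- **The plaquette kernel coupling layer commutes with the centre transformation** as soon as its
kernel data is centre blind on active links — the loop field's blindness IS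
`plaquetteHolonomy_centerTwist`. -/
theorem plaquetteKernelLayer_centerTwist (p : Edge d L → Prop) [DecidablePred p] (ν : Edge d L → Fin d)
    (h : GaugeConfig d L G → Edge d L → G → G)
    (hh : ∀ (V : GaugeConfig d L G) (e : Edge d L), p e → h (centerTwist z t₀ V) e = h V e)
    (V : GaugeConfig d L G) :
    (fun e : Edge d L =>
        if p e then
          h (centerTwist z t₀ V) e (plaquetteHolonomy (centerTwist z t₀ V) e.1 e.2 (ν e)) *
            (plaquetteHolonomy (centerTwist z t₀ V) e.1 e.2 (ν e))⁻¹ * centerTwist z t₀ V e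
        else centerTwist z t₀ V e) =
      centerTwist z t₀ (fun e : Edge d L =>
        if p e then h V e (plaquetteHolonomy V e.1 e.2 (ν e)) * (plaquetteHolonomy V e.1 e.2 (ν e))⁻¹ * V e
        else V e) :=
  kernelLayer_centerTwist hz t₀ p (fun W e => plaquetteHolonomy W e.1 e.2 (ν e)) h
    (fun W e => if p e then h W e (plaquetteHolonomy W e.1 e.2 (ν e)) * (plaquetteHolonomy W e.1 e.2 (ν e))⁻¹ * W e
      else W e)
    (fun _ _ => rfl) (fun W e _ => plaquetteHolonomy_centerTwist hz t₀ W e.1 e.2 (ν e)) hh V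

end AnyGroup

/-! ## Abelian groups (the engine's `U(1)`): every slice twist is a symmetry -/

section Abelian

variable {G : Type*} [CommGroup G]

/-- **For a commutative link group every slice twist commutes with the plaquette kernel coupling
layer** — `z` arbitrary (the centre is the whole group): the `U(1)` NCP / spline plaquette coupling
layers of `U1SplinePlaquetteCouplingLayer` / `U1DegreeOnePlaquetteCouplingLayer` (kernel field
`hol V e` reading frozen links, twist blind on active links) commute with the one-parameter family
`U(x⃗,t₀;0) ↦ z·U(x⃗,t₀;0)`, `z ∈ G`. -/
theorem abelian_plaquetteKernelLayer_sliceTwist (z : G) (t₀ : ZMod L) (p : Edge d L → Prop) [DecidablePred p]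
    (ν : Edge d L → Fin d) (hol : GaugeConfig d L G → Edge d L → G → G)
    (hhol : ∀ (V : GaugeConfig d L G) (e : Edge d L), p e → hol (centerTwist z t₀ V) e = hol V e)
    (V : GaugeConfig d L G) :
    (fun e : Edge d L =>
        if p e then
          hol (centerTwist z t₀ V) e (plaquetteHolonomy (centerTwist z t₀ V) e.1 e.2 (ν e)) *
            (plaquetteHolonomy (centerTwist z t₀ V) e.1 e.2 (ν e))⁻¹ * centerTwist z t₀ V e
        else centerTwist z t₀ V e) =
      centerTwist z t₀ (fun e : Edge d L =>
        if p e then hol V e (plaquetteHolonomy V e.1 e.2 (ν e)) * (plaquetteHolonomy V e.1 e.2 (ν e))⁻¹ * V e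
        else V e) :=
  plaquetteKernelLayer_centerTwist (Subgroup.mem_center_iff.2 fun g => mul_comm g z) t₀ p ν hol hhol V

end Abelian

/-! ## Exact Jacobians of automorphisms commuting with the twist are centre blind -/

section Jacobian

variable [NeZero L] {G : Type*} [Group G] [TopologicalSpace G] [IsTopologicalGroup G] [CompactSpace G]
  [MeasurableSpace G] [BorelSpace G] (z : G) (t₀ : ZMod L)
  (Ψ : GaugeConfig d L G ≃ᵐ GaugeConfig d L G)
  (hΨ : ∀ V : GaugeConfig d L G, Ψ (centerTwistEquiv z t₀ V) = centerTwistEquiv z t₀ (Ψ V))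
include hΨ

/-- **Every exact Jacobian of a measurable automorphism of `G^E` commuting with the twist is centre
blind almost everywhere** (product Haar; left invariance of Haar makes the twist measure preserving). -/
theorem ae_centerInvariant_jacobian_of_comm {J : GaugeConfig d L G → ℝ≥0∞}
    (h : HasJacobian (Measure.pi fun _ : Edge d L => haarProbability G) Ψ J) :
    ∀ᵐ U ∂(Measure.pi fun _ : Edge d L => haarProbability G), J (centerTwist z t₀ U) = J U := by
  have hae := h.jac_comp_symm_ae_eq (centerTwistEquiv z t₀)
    ⟨(centerTwistEquiv z t₀).measurable, map_centerTwist_pi_haar z t₀⟩ hΨ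
  filter_upwards [hae] with U hU
  exact hU

/-- **… and everywhere for a continuous exact Jacobian `j ≥ 0`** (second-countable `G`). -/
theorem centerInvariant_jacobian_of_comm [SecondCountableTopology G] {j : GaugeConfig d L G → ℝ}
    (hj : Continuous j) (hj0 : ∀ U, 0 ≤ j U)
    (h : HasJacobian (Measure.pi fun _ : Edge d L => haarProbability G) Ψ (fun U => ENNReal.ofReal (j U)))
    (U : GaugeConfig d L G) : j (centerTwist z t₀ U) = j U := by
  haveI : (haarProbability G).IsOpenPosMeasure := by unfold haarProbability; infer_instance
  have hTc : Continuous (centerTwistEquiv (d := d) (L := L) z t₀) := by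
    change Continuous fun U : GaugeConfig d L G => centerTwist z t₀ U
    exact continuous_const.mul continuous_id
  have h1 := HasJacobian.jac_comp_symm_eq hj h (centerTwistEquiv z t₀)
    ⟨(centerTwistEquiv z t₀).measurable, map_centerTwist_pi_haar z t₀⟩ hTc hΨ U
  exact (ENNReal.ofReal_eq_ofReal_iff (hj0 _) (hj0 _)).1 h1

/-- **The model density `(r/j) ∘ Ψ⁻¹` of such a flow is centre blind** for a centre-blind prior
density `r` and a continuous exact Jacobian `j ≥ 0`. -/
theorem centerInvariant_modelDensity_of_comm [SecondCountableTopology G] {j r : GaugeConfig d L G → ℝ}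
    (hj : Continuous j) (hj0 : ∀ U, 0 ≤ j U)
    (h : HasJacobian (Measure.pi fun _ : Edge d L => haarProbability G) Ψ (fun U => ENNReal.ofReal (j U)))
    (hr : ∀ V : GaugeConfig d L G, r (centerTwist z t₀ V) = r V) (U : GaugeConfig d L G) :
    r (Ψ.symm (centerTwist z t₀ U)) / j (Ψ.symm (centerTwist z t₀ U)) = r (Ψ.symm U) / j (Ψ.symm U) := by
  have hsymm : Ψ.symm (centerTwist z t₀ U) = centerTwist z t₀ (Ψ.symm U) := by
    apply Ψ.injective
    have h2 := hΨ (Ψ.symm U)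
    rw [centerTwistEquiv_apply, centerTwistEquiv_apply, Ψ.apply_symm_apply] at h2
    rw [Ψ.apply_symm_apply, h2]
  rw [hsymm, hr, centerInvariant_jacobian_of_comm z t₀ Ψ hΨ hj hj0 h (Ψ.symm U)]

end Jacobian

end Summit.Ventures.LatticeQCDFlow.Exactness

end
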